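import Mathlib
import Literature.Barriers.ValiantsHypothesis.AlgebraicNaturalProofs
import Literature.Computability.AlgebraicComplexity.ArithCircuitProofs
import Literature.Computability.AlgebraicComplexity.HomogeneousComponentsComplexity
import Summits.ValiantsHypothesis.ValiantsHypothesis.Theorems.BarrierLeverPartitionMinorsHitByVPAdditiveCoefficients

/-!
# Route BarrierLever — item `PartitionMinorsHitByVP` (stmt-ValiantsHypothesis-19717):
# the ADDITIVE DOOR, part 2/2 — size, truncation to degree `2h`, the door

Helper file (`--supports stmt-ValiantsHypothesis-19717`; cell valiant-natproofs, rung V4, 𝒟-side,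
prover seat val-np-p6 gen 3). Definition-free. Closes NO item.

The additive witness `F(ω₀, ω) = ∏_c (1 + ω₀ c·y_c) · ∏_a (1 + x_a·∏_c (1 + ω a c·y_c))` of part 1
(`…AdditiveCoefficients.coeff_additiveWitness`: `coeff_{x^S y^T} F = ∏_{c∈T} (ω₀ c + Σ_{a∈S} ω a c)`)
has size `≤ 3h² + 6h + 1` (`complexity_additiveWitness_le`) but degree `h + h²`; its truncation
`Σ_{e ≤ 2h} F^{(e)}` (Bürgisser–Clausen–Shokrollahi Lemma 21.25, tree lemma
`complexity_sum_homogeneousComponent_le`) keeps every coefficient of degree `≤ 2h` — in particular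
all `x^S y^T` — and has degree `≤ 2h`, size `≤ (2h+2)²(3h²+6h+1) + 2h + 1 ≤ (h+h)^5` for `h ≥ 2`
(`truncation_spec`, generic).

* **`partitionMinor_hit_of_additive`** — THE ADDITIVE DOOR (ι-indexed layouts, explicit size): if SOME
  table `(ω₀, ω)` gives `det [∏_{c ∈ w j} (ω₀ c + Σ_{a ∈ u i} ω a c)]_{i,j} ≠ 0`, the layout matrix of
  `(u, w)` is nonsingular at some `f`, `deg f ≤ 2h`, `L(f) ≤ (2h+2)²(3h²+6h+1) + 2h + 1`;
* **`partitionMinor_hit_of_additive_mem`** — the same with `f ∈ SmallCircuits ℂ (h+h) 5` (`h ≥ 2`).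

Equivalently: the layout is hit as soon as the points `P_S = ω₀ + Σ_{a∈S} ω a` (`S` a row set) are
unisolvent for the square-free monomials `{z^T : T a column set}` for ONE table. First unconditional
classes through this door (OR-projection layouts) follow in `…PartitionMinorsHitByVPOrProjections`.
WHAT THIS IS NOT: which layouts admit such a table is open in general (generic-table evidence in the
seat memo); nothing on crux 14610 or VP vs VNP.
-/

set_option linter.dupNamespace false

namespace Summit.ValiantsHypothesis.ValiantsHypothesis.Theorems.BarrierLever.AdditiveDoor

open Finset MvPolynomial
open Literature.Barriers.ValiantsHypothesis Literature.Computability.AlgebraicComplexity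

noncomputable section

variable {h : ℕ}

/-! ## 3. Size and degree; truncation to degree `2h` -/

/-- An elementary factor `1 + C t · X v` has size `≤ 2`. -/
theorem complexity_one_add_C_mul_X_le {σ : Type*} (t : ℂ) (v : σ) :
    complexity (1 + C t * X v : MvPolynomial σ ℂ) ≤ 2 := by
  calc complexity (1 + C t * X v : MvPolynomial σ ℂ)
      ≤ complexity (1 : MvPolynomial σ ℂ) + complexity (C t * X v : MvPolynomial σ ℂ) + 1 :=
        complexity_add_le_holds _ _
    _ ≤ 0 + (complexity (C t : MvPolynomial σ ℂ) + complexity (X v : MvPolynomial σ ℂ) + 1) + 1 := by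
        gcongr
        · rw [← C_1, complexity_C_holds]
        · exact complexity_mul_le_holds _ _
    _ = 2 := by rw [complexity_C_holds, complexity_X_holds]

/-- A row factor `∏_c (1 + C (t c) · y_c)` has size `≤ 3h`. -/
theorem complexity_rowFactor_le (t : Fin h → ℂ) :
    complexity (∏ c : Fin h, (1 + C (t c) * X (Fin.natAdd h c)) : MvPolynomial (Fin (h + h)) ℂ) ≤
      3 * h := by
  calc _ ≤ ∑ c : Fin h, complexity (1 + C (t c) * X (Fin.natAdd h c) : MvPolynomial (Fin (h + h)) ℂ) +
        (Finset.univ : Finset (Fin h)).card := complexity_finset_prod_le _ _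
    _ ≤ ∑ _c : Fin h, 2 + (Finset.univ : Finset (Fin h)).card := by
        gcongr with c _; exact complexity_one_add_C_mul_X_le _ _
    _ = 3 * h := by simp; ring

/-- **Size of the additive witness**: `≤ 3h² + 6h + 1`. -/
theorem complexity_additiveWitness_le (ω₀ : Fin h → ℂ) (ω : Fin h → Fin h → ℂ) :
    complexity ((∏ c : Fin h, (1 + C (ω₀ c) * X (Fin.natAdd h c))) *
        ∏ a : Fin h, (1 + X (Fin.castAdd h a) * ∏ c : Fin h, (1 + C (ω a c) * X (Fin.natAdd h c))) :
        MvPolynomial (Fin (h + h)) ℂ) ≤ 3 * h * h + 6 * h + 1 := by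
  have hfac : ∀ a : Fin h, complexity (1 + X (Fin.castAdd h a) *
      ∏ c : Fin h, (1 + C (ω a c) * X (Fin.natAdd h c)) : MvPolynomial (Fin (h + h)) ℂ) ≤
      3 * h + 2 := by
    intro a
    calc _ ≤ complexity (1 : MvPolynomial (Fin (h + h)) ℂ) + complexity (X (Fin.castAdd h a) *
          ∏ c : Fin h, (1 + C (ω a c) * X (Fin.natAdd h c)) : MvPolynomial (Fin (h + h)) ℂ) + 1 :=
          complexity_add_le_holds _ _
      _ ≤ 0 + (complexity (X (Fin.castAdd h a) : MvPolynomial (Fin (h + h)) ℂ) +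
          complexity (∏ c : Fin h, (1 + C (ω a c) * X (Fin.natAdd h c)) :
            MvPolynomial (Fin (h + h)) ℂ) + 1) + 1 := by
          gcongr
          · rw [← C_1, complexity_C_holds]
          · exact complexity_mul_le_holds _ _
      _ ≤ 0 + (0 + 3 * h + 1) + 1 := by
          gcongr
          · exact (complexity_X_holds _).le
          · exact complexity_rowFactor_le _
      _ = 3 * h + 2 := by ring
  calc _ ≤ complexity (∏ c : Fin h, (1 + C (ω₀ c) * X (Fin.natAdd h c)) : MvPolynomial (Fin (h + h)) ℂ) +
        complexity (∏ a : Fin h, (1 + X (Fin.castAdd h a) *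
          ∏ c : Fin h, (1 + C (ω a c) * X (Fin.natAdd h c))) : MvPolynomial (Fin (h + h)) ℂ) + 1 :=
        complexity_mul_le_holds _ _
    _ ≤ 3 * h + (∑ a : Fin h, complexity (1 + X (Fin.castAdd h a) *
          ∏ c : Fin h, (1 + C (ω a c) * X (Fin.natAdd h c)) : MvPolynomial (Fin (h + h)) ℂ) +
          (Finset.univ : Finset (Fin h)).card) + 1 := by
        gcongr
        · exact complexity_rowFactor_le _
        · exact complexity_finset_prod_le _ _
    _ ≤ 3 * h + (∑ _a : Fin h, (3 * h + 2) + (Finset.univ : Finset (Fin h)).card) + 1 := by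
        gcongr with a _; exact hfac a
    _ = 3 * h * h + 6 * h + 1 := by simp; ring

/-- **Truncation** (generic): `Σ_{e ≤ N} f^{(e)}` has degree `≤ N`, the coefficients of `f` on all
monomials of degree `≤ N`, and size `≤ (N+2)² L(f) + N + 1` (BCS Lemma 21.25, in tree). -/
theorem truncation_spec {σ : Type*} (f : MvPolynomial σ ℂ) (N : ℕ) :
    (∑ e ∈ Finset.range (N + 1), homogeneousComponent e f).totalDegree ≤ N ∧
    (∀ d : σ →₀ ℕ, d.degree ≤ N →
      coeff d (∑ e ∈ Finset.range (N + 1), homogeneousComponent e f) = coeff d f) ∧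
    complexity (∑ e ∈ Finset.range (N + 1), homogeneousComponent e f) ≤
      (N + 2) ^ 2 * complexity f + (N + 1) := by
  refine ⟨?_, ?_, complexity_sum_homogeneousComponent_le f N⟩
  · refine totalDegree_finsetSum_le fun e he => ?_
    exact (homogeneousComponent_isHomogeneous e f).totalDegree_le.trans
      (Nat.lt_succ_iff.mp (Finset.mem_range.mp he))
  · intro d hdN
    rw [coeff_sum]
    simp_rw [coeff_homogeneousComponent]
    rw [Finset.sum_ite_eq, if_pos (Finset.mem_range.mpr (Nat.lt_succ_of_le hdN))]

/-- The degree of a partition exponent is at most `h + h`. -/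
theorem degree_partitionExpo_le (S T : Finset (Fin h)) :
    (∑ a ∈ S, Finsupp.single (Fin.castAdd h a) 1 +
      ∑ c ∈ T, Finsupp.single (Fin.natAdd h c) 1 : Fin (h + h) →₀ ℕ).degree ≤ h + h := by
  rw [Finsupp.degree_apply]
  calc _ ≤ ∑ t ∈ (∑ a ∈ S, Finsupp.single (Fin.castAdd h a) 1 +
        ∑ c ∈ T, Finsupp.single (Fin.natAdd h c) 1 : Fin (h + h) →₀ ℕ).support, 1 :=
        Finset.sum_le_sum fun t _ => partitionExpo_le_one S T t
    _ ≤ ∑ _t : Fin (h + h), 1 := Finset.sum_le_sum_of_subset_of_nonneg (Finset.subset_univ _)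
        (fun _ _ _ => zero_le_one)
    _ = h + h := by simp

/-! ## 4. The door -/

/-- **THE ADDITIVE DOOR (explicit size).** If the additive table `(ω₀, ω)` makes
`det [∏_{c ∈ w j} (ω₀ c + Σ_{a ∈ u i} ω a c)]_{i,j} ≠ 0`, the layout `(u, w)` has a nonsingular
partition matrix at some `f` with `deg f ≤ 2h` and `L(f) ≤ (2h+2)²(3h²+6h+1) + 2h + 1`. -/
theorem partitionMinor_hit_of_additive {ι : Type*} [Fintype ι] [DecidableEq ι] (h : ℕ)
    (u w : ι → Finset (Fin h)) (ω₀ : Fin h → ℂ) (ω : Fin h → Fin h → ℂ)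
    (hdet : (Matrix.of fun i j : ι => ∏ c ∈ w j, (ω₀ c + ∑ a ∈ u i, ω a c)).det ≠ 0) :
    ∃ f : MvPolynomial (Fin (h + h)) ℂ, f.totalDegree ≤ h + h ∧
      complexity f ≤ (h + h + 2) ^ 2 * (3 * h * h + 6 * h + 1) + (h + h + 1) ∧
      (Matrix.of fun i j : ι => MvPolynomial.coeff
        (∑ a ∈ u i, Finsupp.single (Fin.castAdd h a) 1 +
          ∑ c ∈ w j, Finsupp.single (Fin.natAdd h c) 1) f).det ≠ 0 := by
  set F : MvPolynomial (Fin (h + h)) ℂ := (∏ c : Fin h, (1 + C (ω₀ c) * X (Fin.natAdd h c))) *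
    ∏ a : Fin h, (1 + X (Fin.castAdd h a) * ∏ c : Fin h, (1 + C (ω a c) * X (Fin.natAdd h c)))
    with hF
  obtain ⟨hdeg, hcoeff, hsize⟩ := truncation_spec F (h + h)
  refine ⟨∑ e ∈ Finset.range (h + h + 1), homogeneousComponent e F, hdeg, ?_, ?_⟩
  · exact hsize.trans (by have := complexity_additiveWitness_le ω₀ ω; rw [← hF] at this; gcongr)
  · have hmat : (Matrix.of fun i j : ι => MvPolynomial.coeff
        (∑ a ∈ u i, Finsupp.single (Fin.castAdd h a) 1 +
          ∑ c ∈ w j, Finsupp.single (Fin.natAdd h c) 1)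
        (∑ e ∈ Finset.range (h + h + 1), homogeneousComponent e F)) =
        Matrix.of fun i j : ι => ∏ c ∈ w j, (ω₀ c + ∑ a ∈ u i, ω a c) := by
      ext i j
      rw [Matrix.of_apply, Matrix.of_apply, hcoeff _ (degree_partitionExpo_le _ _), hF,
        coeff_additiveWitness]
    rw [hmat]
    exact hdet

/-- **THE ADDITIVE DOOR (class form).** For `h ≥ 2` the witness lies in `SmallCircuits ℂ (h+h) 5`. -/
theorem partitionMinor_hit_of_additive_mem {ι : Type*} [Fintype ι] [DecidableEq ι] (h : ℕ)
    (hh : 2 ≤ h) (u w : ι → Finset (Fin h)) (ω₀ : Fin h → ℂ) (ω : Fin h → Fin h → ℂ)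
    (hdet : (Matrix.of fun i j : ι => ∏ c ∈ w j, (ω₀ c + ∑ a ∈ u i, ω a c)).det ≠ 0) :
    ∃ f ∈ SmallCircuits ℂ (h + h) 5,
      (Matrix.of fun i j : ι => MvPolynomial.coeff
        (∑ a ∈ u i, Finsupp.single (Fin.castAdd h a) 1 +
          ∑ c ∈ w j, Finsupp.single (Fin.natAdd h c) 1) f).det ≠ 0 := by
  obtain ⟨f, hdeg, hsize, hf⟩ := partitionMinor_hit_of_additive h u w ω₀ ω hdet
  refine ⟨f, ⟨hdeg, hsize.trans ?_⟩, hf⟩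
  have h4 : 4 ≤ h + h := by omega
  have key : (h + h + 2) ^ 2 * (3 * h * h + 6 * h + 1) + (h + h + 1) ≤ (h + h) ^ 5 := by
    have e1 : h + h + 2 ≤ 3 * h := by omega
    have e2 : 3 * h * h + 6 * h + 1 ≤ 7 * h * h := by nlinarith
    have e3 : h + h + 1 ≤ h * h * h * h := by nlinarith
    calc (h + h + 2) ^ 2 * (3 * h * h + 6 * h + 1) + (h + h + 1)
        ≤ (3 * h) ^ 2 * (7 * h * h) + h * h * h * h := by gcongr
      _ = 64 * (h * h * h * h) := by ring
      _ ≤ (h + h) * (16 * (h * h * h * h)) := by nlinarith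
      _ = (h + h) ^ 5 := by ring
  exact key

end

end Summit.ValiantsHypothesis.ValiantsHypothesis.Theorems.BarrierLever.AdditiveDoor
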